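import Summits.QuantumFields.YangMills.Theorems.LuscherReductionRunningReductionOrbitDist
import Summits.QuantumFields.YangMills.Theorems.LuscherReductionRunningReductionLatticeIMSDefect
import Literature.MathematicalPhysics.QuantumFieldTheory.Balaban1983to89.B5TorusPartition
import HarnessLib

/-!
# The twist-symmetrised INNER phase on `(ℤ/L)³`: a gauge- AND twist-invariant, link-Lipschitz angle `Θ_δ` that vanishes near the eight torons
# and equals `π/2` away from them (sub-stub C2b of the fixed-lattice programme COARSE(L₀) — route `LuscherReduction`, crux RED
# stmt-QuantumFields-19978 KT-door 3b′ / crux `TwistedTraceScaling` stmt-QuantumFields-20203 S-BASE; design note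
# `pub/ym-fleet/ym-luscher-20007-p1/COARSE-DESIGN.md` §2)

`orbitDist` (`…RunningReductionOrbitDist.lean`) is gauge-invariant but not twist-invariant: the eight torons `twist3 z 1̄` (`z : Fin 3 → Bool`)
are one zero-flux class.  Physical (zero-flux) IMS cut-offs must be twist-invariant, so the INNER region is the union of the eight
neighbourhoods `{orbitDist (twist3 z U) < δ}` and the phase is the symmetric PRODUCT (no disjointness of the neighbourhoods is needed):

  `bump t = min 1 (max 0 (2 − 2t))`  (`= 1` for `t ≤ ½`, `= 0` for `t ≥ 1`, `2`-Lipschitz, values in `[0,1]`),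
  `innerPhase δ U = (π/2) · ∏_{z : Fin 3 → Bool} (1 − bump (orbitDist (twist3 z U) / δ))`.

Proved: values in `[0, π/2]`; **gauge invariance** (`innerPhase_gaugeTransform`); **twist invariance** (`innerPhase_twist`: a centre twist
permutes the eight `z`); **link-Lipschitz** `|Θ(U) − Θ(V)| ≤ (8π/δ) Σ_e ‖U_e − V_e‖_F` (`abs_innerPhase_sub_le`); measurability; and the two
support facts the IMS lanes use: `sin Θ(U) ≠ 0 ⇒ ∀ z, δ/2 < orbitDist (twist3 z U)` (the `sin`-piece lives in the OUTER region) and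
`cos Θ(U) ≠ 0 ⇒ ∃ z, orbitDist (twist3 z U) < δ` (the `cos`-piece lives in the INNER region).  With `qform_le_localized_cos_sin_lat` (p527446)
this gives, for every physical `ψ` and `δ > 0`, the lattice IMS split
`⟨ψ,Kψ⟩ ≤ ⟨cosΘ ψ, K cosΘ ψ⟩ + ⟨sinΘ ψ, K sinΘ ψ⟩ + ½|E|²(8π/δ)²(3/β)c^{|E|}‖ψ‖²` (`qform_le_inner_outer_lat`).
HONEST FRAMING: cut-off bookkeeping only; femto rung R2b1; not a gap, not Clay.
-/

set_option autoImplicit false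

noncomputable section

open MeasureTheory Filter Topology Real
open scoped Matrix ComplexConjugate BigOperators
open Literature.MathematicalPhysics.QuantumFieldTheory
open Literature.MathematicalPhysics.QuantumLattice

namespace Summit.QuantumFields.YangMills.Theorems.FemtoTransferGap

variable {L : ℕ} [NeZero L]

/-! ## §1 The bump profile -/

/-- The piecewise-linear bump `min 1 (max 0 (2 − 2t))`: `1` on `t ≤ ½`, `0` on `t ≥ 1`. [folklore] -/
def bump (t : ℝ) : ℝ := min 1 (max 0 (2 - 2 * t))

/-- `0 ≤ bump t`. [folklore] -/
theorem bump_nonneg (t : ℝ) : 0 ≤ bump t := le_min zero_le_one (le_max_left _ _)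

/-- `bump t ≤ 1`. [folklore] -/
theorem bump_le_one (t : ℝ) : bump t ≤ 1 := min_le_left _ _

/-- `bump t = 1` for `t ≤ ½`. [folklore] -/
theorem bump_eq_one {t : ℝ} (ht : t ≤ 1 / 2) : bump t = 1 := by
  unfold bump
  rw [min_eq_left]
  exact le_trans (by linarith) (le_max_right _ _)

/-- `bump t = 0` for `t ≥ 1`. [folklore] -/
theorem bump_eq_zero {t : ℝ} (ht : 1 ≤ t) : bump t = 0 := by
  unfold bump
  rw [max_eq_left (by linarith), min_eq_right zero_le_one]

/-- If `bump t ≠ 1` then `½ < t`. [folklore] -/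
theorem half_lt_of_bump_ne_one {t : ℝ} (h : bump t ≠ 1) : 1 / 2 < t := by
  by_contra h'; exact h (bump_eq_one (not_lt.1 h'))

/-- If `bump t ≠ 0` then `t < 1`. [folklore] -/
theorem lt_one_of_bump_ne_zero {t : ℝ} (h : bump t ≠ 0) : t < 1 := by
  by_contra h'; exact h (bump_eq_zero (not_lt.1 h'))

/-- `bump` is `2`-Lipschitz. [folklore] -/
theorem abs_bump_sub_le (s t : ℝ) : |bump s - bump t| ≤ 2 * |s - t| := by
  unfold bump
  have h1 : |max 0 (2 - 2 * s) - max 0 (2 - 2 * t)| ≤ |(2 - 2 * s) - (2 - 2 * t)| := by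
    refine (abs_max_sub_max_le_max 0 (2 - 2 * s) 0 (2 - 2 * t)).trans ?_
    rw [sub_self, abs_zero, max_eq_right (abs_nonneg _)]
  have h2 : |min 1 (max 0 (2 - 2 * s)) - min 1 (max 0 (2 - 2 * t))| ≤ |max 0 (2 - 2 * s) - max 0 (2 - 2 * t)| := by
    refine (abs_min_sub_min_le_max 1 (max 0 (2 - 2 * s)) 1 (max 0 (2 - 2 * t))).trans ?_
    rw [sub_self, abs_zero, max_eq_right (abs_nonneg _)]
  have h3 : |(2 - 2 * s) - (2 - 2 * t)| = 2 * |s - t| := by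
    rw [show (2 - 2 * s) - (2 - 2 * t) = -(2 * (s - t)) by ring, abs_neg, abs_mul, abs_of_pos (by norm_num : (0:ℝ) < 2)]
  linarith

/-- `bump` is continuous. [folklore] -/
theorem continuous_bump : Continuous bump :=
  continuous_const.min (continuous_const.max (continuous_const.sub (continuous_const.mul continuous_id)))

/-! ## §2 The inner phase -/

/-- **The twist-symmetrised inner phase** `Θ_δ(U) = (π/2) ∏_z (1 − bump (orbitDist (twist3 z U)/δ))`, `z : Fin 3 → Bool` the eight composite
centre twists. [cite: Luscher1983, §2] [cite: SimonB1983DiscreteSpectrum, §3] -/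
def innerPhase (δ : ℝ) (U : GaugeConfig 3 L SU2) : ℝ :=
  (π / 2) * ∏ z : Fin 3 → Bool, (1 - bump (orbitDist (TT.twist3 z U) / δ))

/-- Each factor lies in `[0,1]`. [folklore] -/
theorem innerFactor_mem (δ : ℝ) (U : GaugeConfig 3 L SU2) (z : Fin 3 → Bool) :
    0 ≤ 1 - bump (orbitDist (TT.twist3 z U) / δ) ∧ 1 - bump (orbitDist (TT.twist3 z U) / δ) ≤ 1 :=
  ⟨by linarith [bump_le_one (orbitDist (TT.twist3 z U) / δ)], by linarith [bump_nonneg (orbitDist (TT.twist3 z U) / δ)]⟩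

/-- The product of the factors lies in `[0,1]`. [folklore] -/
theorem innerProd_mem (δ : ℝ) (U : GaugeConfig 3 L SU2) :
    0 ≤ ∏ z : Fin 3 → Bool, (1 - bump (orbitDist (TT.twist3 z U) / δ)) ∧
      ∏ z : Fin 3 → Bool, (1 - bump (orbitDist (TT.twist3 z U) / δ)) ≤ 1 :=
  ⟨Finset.prod_nonneg fun z _ => (innerFactor_mem δ U z).1,
    Finset.prod_le_one (fun z _ => (innerFactor_mem δ U z).1) fun z _ => (innerFactor_mem δ U z).2⟩

/-- `0 ≤ Θ_δ ≤ π/2`. [folklore] -/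
theorem innerPhase_mem (δ : ℝ) (U : GaugeConfig 3 L SU2) : 0 ≤ innerPhase δ U ∧ innerPhase δ U ≤ π / 2 := by
  have hπ : 0 < π / 2 := by positivity
  obtain ⟨h0, h1⟩ := innerProd_mem δ U
  unfold innerPhase
  exact ⟨mul_nonneg hπ.le h0, by nlinarith⟩

/-! ## §3 Invariance -/

/-- **Gauge invariance** of the inner phase. [folklore] -/
theorem innerPhase_gaugeTransform (δ : ℝ) (g : Site 3 L → SU2) (U : GaugeConfig 3 L SU2) :
    innerPhase δ (gaugeTransform g U) = innerPhase δ U := by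
  have key : (∏ z : Fin 3 → Bool, (1 - bump (orbitDist (TT.twist3 z (gaugeTransform g U)) / δ))) =
      ∏ z : Fin 3 → Bool, (1 - bump (orbitDist (TT.twist3 z U) / δ)) :=
    Finset.prod_congr rfl fun z _ => by rw [orbitDist_twist3_gaugeTransform]
  rw [innerPhase, innerPhase, key]

/-- A composite twist permutes the eight twisted orbit distances, leaving the inner phase invariant. [folklore] -/
theorem innerPhase_twist3 (δ : ℝ) (w : Fin 3 → Bool) (U : GaugeConfig 3 L SU2) :
    innerPhase δ (TT.twist3 w U) = innerPhase δ U := by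
  -- reindex the product by the involution `z ↦ z xor w`
  have hinv : Function.Involutive (fun z : Fin 3 → Bool => fun k => Bool.xor (z k) (w k)) := by
    intro z; funext k; simp
  have key : (∏ z : Fin 3 → Bool, (1 - bump (orbitDist (TT.twist3 z (TT.twist3 w U)) / δ))) =
      ∏ z : Fin 3 → Bool, (1 - bump (orbitDist (TT.twist3 z U) / δ)) := by
    refine Fintype.prod_bijective (fun z : Fin 3 → Bool => fun k => Bool.xor (z k) (w k)) hinv.bijective _ _ fun z => ?_
    rw [TT.twist3_twist3]
  rw [innerPhase, innerPhase, key]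

/-- **Twist invariance** of the inner phase: `Θ_δ(twist k c U) = Θ_δ(U)` for every central `c`. [cite: tHooft1979] -/
theorem innerPhase_twist (δ : ℝ) (k : Fin 3) {c : SU2} (hc : c ∈ Subgroup.center SU2) (U : GaugeConfig 3 L SU2) :
    innerPhase δ (twist k c U) = innerPhase δ U := by
  obtain ⟨b, rfl⟩ := TT.exists_eq_centreElem_of_mem_center hc
  rw [TT.twist_centreElem_eq_twist3, innerPhase_twist3]

/-! ## §4 Link-Lipschitz continuity and measurability -/

/-- ★ **The inner phase is link-Lipschitz**: `|Θ_δ(U) − Θ_δ(V)| ≤ (8π/δ) Σ_e ‖U_e − V_e‖_F` (`δ > 0`). [folklore] -/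
theorem abs_innerPhase_sub_le {δ : ℝ} (hδ : 0 < δ) (U V : GaugeConfig 3 L SU2) :
    |innerPhase δ U - innerPhase δ V| ≤
      (8 * π / δ) * ∑ e : Edge 3 L, frobNorm (((U e : SU2) : Matrix (Fin 2) (Fin 2) ℂ) - ((V e : SU2) : Matrix (Fin 2) (Fin 2) ℂ)) := by
  set D := ∑ e : Edge 3 L, frobNorm (((U e : SU2) : Matrix (Fin 2) (Fin 2) ℂ) - ((V e : SU2) : Matrix (Fin 2) (Fin 2) ℂ)) with hD
  have hD0 : 0 ≤ D := Finset.sum_nonneg fun _ _ => frobNorm_nonneg _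
  unfold innerPhase
  rw [← mul_sub, abs_mul, abs_of_pos (by positivity : (0 : ℝ) < π / 2)]
  have hprod := Literature.MathematicalPhysics.QuantumFieldTheory.Balaban1983to89.B5TorusPartition.abs_prod_sub_prod_le
    (Finset.univ : Finset (Fin 3 → Bool))
    (fun z => 1 - bump (orbitDist (TT.twist3 z U) / δ)) (fun z => 1 - bump (orbitDist (TT.twist3 z V) / δ))
    (fun z _ => innerFactor_mem δ U z) (fun z _ => innerFactor_mem δ V z)
  have hterm : ∀ z : Fin 3 → Bool,
      |(1 - bump (orbitDist (TT.twist3 z U) / δ)) - (1 - bump (orbitDist (TT.twist3 z V) / δ))| ≤ 2 / δ * D := by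
    intro z
    rw [show (1 - bump (orbitDist (TT.twist3 z U) / δ)) - (1 - bump (orbitDist (TT.twist3 z V) / δ)) =
      -(bump (orbitDist (TT.twist3 z U) / δ) - bump (orbitDist (TT.twist3 z V) / δ)) by ring, abs_neg]
    refine (abs_bump_sub_le _ _).trans ?_
    rw [← sub_div, abs_div, abs_of_pos hδ]
    have h := abs_orbitDist_twist3_sub_le z U V
    rw [show 2 * (|orbitDist (TT.twist3 z U) - orbitDist (TT.twist3 z V)| / δ) =
      2 / δ * |orbitDist (TT.twist3 z U) - orbitDist (TT.twist3 z V)| by ring]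
    exact mul_le_mul_of_nonneg_left h (by positivity)
  have hsum : ∑ z : Fin 3 → Bool, |(1 - bump (orbitDist (TT.twist3 z U) / δ)) - (1 - bump (orbitDist (TT.twist3 z V) / δ))| ≤
      8 * (2 / δ * D) := by
    refine (Finset.sum_le_sum fun z _ => hterm z).trans ?_
    rw [Finset.sum_const, Finset.card_univ, nsmul_eq_mul]
    have hcard : (Fintype.card (Fin 3 → Bool) : ℝ) = 8 := by norm_num [Fintype.card_fun]
    rw [hcard]
  calc π / 2 * |∏ z : Fin 3 → Bool, (1 - bump (orbitDist (TT.twist3 z U) / δ)) -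
        ∏ z : Fin 3 → Bool, (1 - bump (orbitDist (TT.twist3 z V) / δ))|
      ≤ π / 2 * (8 * (2 / δ * D)) := mul_le_mul_of_nonneg_left (hprod.trans hsum) (by positivity)
    _ = 8 * π / δ * D := by ring

/-- The inner phase is measurable. [folklore] -/
theorem measurable_innerPhase (δ : ℝ) : Measurable (innerPhase (L := L) δ) := by
  unfold innerPhase
  refine Measurable.const_mul ?_ _
  refine Finset.measurable_prod _ fun z _ => ?_
  exact measurable_const.sub (continuous_bump.measurable.comp ((measurable_orbitDist_twist3 z).div_const δ))

/-! ## §5 Supports of the two pieces -/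

/-- **The `sin`-piece lives in the OUTER region**: if `sin Θ_δ(U) ≠ 0` then every twisted orbit distance exceeds `δ/2` (`δ > 0`). [folklore] -/
theorem forall_lt_orbitDist_of_sin_ne_zero {δ : ℝ} (hδ : 0 < δ) {U : GaugeConfig 3 L SU2} (h : Real.sin (innerPhase δ U) ≠ 0) :
    ∀ z : Fin 3 → Bool, δ / 2 < orbitDist (TT.twist3 z U) := by
  intro z
  by_contra hz
  rw [not_lt] at hz
  apply h
  have hb : bump (orbitDist (TT.twist3 z U) / δ) = 1 := bump_eq_one (by rw [div_le_iff₀ hδ]; linarith)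
  have hprod : ∏ w : Fin 3 → Bool, (1 - bump (orbitDist (TT.twist3 w U) / δ)) = 0 :=
    Finset.prod_eq_zero (Finset.mem_univ z) (by rw [hb, sub_self])
  unfold innerPhase
  rw [hprod, mul_zero, Real.sin_zero]

/-- **The `cos`-piece lives in the INNER region**: if `cos Θ_δ(U) ≠ 0` then some twisted orbit distance is `< δ` (`δ > 0`). [folklore] -/
theorem exists_orbitDist_lt_of_cos_ne_zero {δ : ℝ} (hδ : 0 < δ) {U : GaugeConfig 3 L SU2} (h : Real.cos (innerPhase δ U) ≠ 0) :
    ∃ z : Fin 3 → Bool, orbitDist (TT.twist3 z U) < δ := by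
  by_contra hne
  push Not at hne
  apply h
  have hprod : ∏ w : Fin 3 → Bool, (1 - bump (orbitDist (TT.twist3 w U) / δ)) = 1 := by
    refine Finset.prod_eq_one fun w _ => ?_
    rw [bump_eq_zero (by rw [le_div_iff₀ hδ]; linarith [hne w]), sub_zero]
  unfold innerPhase
  rw [hprod, mul_one, Real.cos_pi_div_two]

/-! ## §6 The lattice IMS split into INNER and OUTER pieces -/

/-- ★ **IMS split on the `L³` torus with the inner phase** (`β > 0`, `δ > 0`): for every physical zero-flux `ψ`,
`⟨ψ,K_βψ⟩ ≤ ⟨cosΘ_δ ψ, K cosΘ_δ ψ⟩ + ⟨sinΘ_δ ψ, K sinΘ_δ ψ⟩ + ½ · |E|²(8π/δ)²(3/β) c_β^{|E|} · ‖ψ‖²`. [cite: SimonB1983DiscreteSpectrum, §3] -/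
theorem qform_le_inner_outer_lat {β : ℝ} (hβ : 0 < β) {δ : ℝ} (hδ : 0 < δ) {ψ : GaugeConfig 3 L SU2 → ℝ} (hψ : IsPhys ψ) :
    qform su2Rep β ψ ψ ≤
      qform su2Rep β (fun U => Real.cos (innerPhase δ U) * ψ U) (fun U => Real.cos (innerPhase δ U) * ψ U)
      + qform su2Rep β (fun U => Real.sin (innerPhase δ U) * ψ U) (fun U => Real.sin (innerPhase δ U) * ψ U)
      + (1 / 2) * ((Fintype.card (Edge 3 L) : ℝ) ^ 2 * (8 * π / δ) ^ 2 * (3 / β) * latCE L β) * l2 ψ ψ :=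
  qform_le_localized_cos_sin_lat hβ (measurable_innerPhase δ) (by positivity) (abs_innerPhase_sub_le hδ)
    (fun g U => innerPhase_gaugeTransform δ g U) (fun k c hc U => innerPhase_twist δ k hc U) hψ

end Summit.QuantumFields.YangMills.Theorems.FemtoTransferGap

end
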